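import Literature.NumberTheory.EllipticCurves.PAdicLFunctionRiemannSumCongruenceCertificateProofs
import Literature.NumberTheory.EllipticCurves.ModPReducibilityProofs
import Literature.NumberTheory.EllipticCurves.Rank1Residual.MuLambdaCarriers
import Mathlib.Algebra.Group.ForwardDiff
import Mathlib.RingTheory.ZMod.UnitsCyclic
import HarnessLib

/-!
# `μ`-invariant certificates for the Mazur–Tate–Teitelbaum transform: a unit Teichmüller-orbit
# sum ⟺ a unit coefficient; `TeichOrbitNonConstantAt W p ↔ MuAnZeroAt W p` at odd good ordinary `p`
# with `E[p]` irreducible (theorems only — no definition, no named fact)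

Mazur–Tate–Teitelbaum (Invent. Math. 84 (1986), §I.10–I.13): the `p`-adic `L`-function of a weight-2
cusp form `f` at an allowable root `α` is `L_p(f,α,T) = ∑_k c_k T^k`, `c_k = ∫_{ℤ_p^×} (ℓ(x) choose k) dμ_{f,α}`
(`x = η γ^{ℓ(x)}`, `η` Teichmüller, `γ = 1 + p^{e₀}`; tree: `padicLCoeff f α k = lim_n padicLRiemannSum f α k n`,
`PAdicLFunction.lean`). Only the push-forward of `μ_{f,α}|_{ℤ_p^×}` to the `γ`-exponent line enters: the
Riemann sums are `RS(k,n) = ∑_{s mod pⁿ} ν_n(s)·(s choose k)` with the **Teichmüller-orbit sums**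
`ν_n(s) = ∑_η μ_{f,α}(η γˢ + p^{n+e₀}ℤ_p)` (`riemannSum_eq_sum_orbitSum_mul_choose`). For a `ℤ_p`-valued
measure the `μ`-INVARIANT of `L_p` vanishes iff SOME `ν_n(s)` is a `p`-adic unit — the standard "unit content"
criterion (Greenberg–Vatsal 2000 (2)–(3); Emerton–Pollack–Weston 2006 Def. 4.4.1; Pollack–Weston 2011
Prop. 3.7; Chakravarthy 2024 eqn. (1)). This file PROVES both directions in the kernel, for the tree's honest
limit definition of the coefficients, and specialises them to the modular-symbol currency of the census
(`Rank1Residual.teichOrbitSum`, `Rank1Residual.TeichOrbitNonConstantAt`, `MuLambdaCarriers.lean` §4):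

* §0 `norm_le_of_forall_norm_sum_mul_choose_le` — NEWTON INVERSION below degree `pⁿ`: if all
  `∑_s ν(s)(s choose k)`, `k < pⁿ`, lie in a ball then so does every `ν(s)` (Gregory–Newton formula, Mathlib
  `shift_eq_sum_fwdDiff_iter`; the Newton coefficients of an indicator are integers).
* §1 `exists_lt_norm_limUnder_riemannSum_of_lt_norm_orbitSum` — ABSTRACT CERTIFICATE for any bounded
  distribution `μ` on the tower (currency of `PAdicMeasureTransform`): `C·p⁻¹ < ‖ν_n(s₀)‖ ⟹ ∃ k < pⁿ,
  C·p⁻¹ < ‖c_k‖`, from the tree's UNIFORM congruence bound `‖c_k − RS(k,n)‖ ≤ C·p⁻¹` for `k < pⁿ`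
  (`norm_limUnder_riemannSum_sub_le_mul_inv_of_lt_pow`, Lucas) and §0.
* §2 `sum_fiber_orbitSum_succ_eq` (distribution relation of the `ν_n`),
  `norm_limUnder_riemannSum_le_of_forall_norm_orbitSum_sub_le` — the CONVERSE: if at every level the
  `ν_n(s)` are mutually congruent modulo the ball `C·p⁻¹`, then every `‖c_k‖ ≤ C·p⁻¹`.
* §3 odd `p`: the Teichmüller representatives modulo `p^m` are exactly `{t : t^{p−1} = 1}`
  (`image_toZModPow_rootsOfUnity_eq_filter`; cyclicity of `(ℤ/p^m)^×`, Mathlib `ZMod.isCyclic_units_of_prime_pow`),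
  so `teichOrbitSum f p m a = ∑_η [η̄a/p^m]⁺_f` (`teichOrbitSum_eq_finsum`), and MTT (10.1) summed over the
  orbit: `ν_n(s) = α^{−(n+1)} T_{n+1}(γˢ) − α^{−(n+2)} T_n(γˢ)` (`finsum_msdMeasure_orbit_eq`).
* §4 `exists_norm_padicLCoeff_eq_one_of_orbitSymbolSum` (descent on the level: a unit difference of
  `T_{m+1}`-sums forces a unit `ν_m` at some level, isosceles triangle) and
  `norm_padicLCoeff_le_inv_of_orbitSymbolSum` (constancy mod `p` at all levels ⟹ all `c_k ∈ pℤ_p`).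
* §5 `muAnZeroAt_of_teichOrbitNonConstantAt` (AN-S1), `teichOrbitNonConstantAt_of_muAnZeroAt` (AN-S2),
  `teichOrbitNonConstantAt_iff_muAnZeroAt`: for `p ≠ 2`, `IsOrdinaryAt W p`, `W.HasIrreducibleModPGaloisRep p`,
  `TeichOrbitNonConstantAt W p ↔ MuAnZeroAt W p` — the two PAPER bridges AN-S1/AN-S2 of cell `bsd-f3-mu`
  (hypotheses `hS1`/`hS2` of `Summits/…/SmallImageMu/TeichOrbitNonConstancyEdges`) as THEOREMS. Inputs, all
  proved in the tree: `msdMeasure_distribution_of_isNewformOf`, `norm_msdMeasure_le_one` +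
  `exists_intCast_mul_modularSymbol_zero_mem not_irreducible_of_frobeniusTrace_congr_holds` (integrality,
  Greenberg–Vatsal Prop. 3.7 / Stevens for the lattice `Λ_f`), `unitRoot_coe_spec`.

Use (cell `bsd-print-x9`, seat p2 «μ = 0 by congruence transport + analytic μ = 0 certificate», gen 3;
`--supports` the μ-cruxes 19630 `AnalyticMuZeroOnClassX9` / 20682 `AnalyticMuZeroOnClassX10b`): (i) the
conjecture node `TeichOrbitNonConstancyOnClassX9` (AN-1) becomes EQUIVALENT to item 19630 in the kernel;
(ii) every two-engine `μ = 0` certificate of the census (exact plus symbols at one level) is now a kernel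
display of `MuAnZeroAt W p`; (iii) at `p = 3` the Teichmüller orbit is `{±u}` and `[·]⁺` is even, so
`ν_n(s) = 2·μ_{f,α}(γˢ + 3^{n+1}ℤ₃)`: this is the measure→coefficient half of the `p = 3` collapse of line
`theoremB-x10b` on crux 20682. No hypothesis on the image of `ρ̄_{E,p}` beyond irreducibility enters.
HONEST FRAMING: nothing about any curve is asserted; beyond-print theorem: no (MTT folklore made kernel).

## References

* B. Mazur, J. Tate, J. Teitelbaum, *On `p`-adic analogues of the conjectures of Birch and
  Swinnerton-Dyer*, Invent. Math. 84 (1986), §I.10 (10.1)–(10.2), §I.11–I.13.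
* R. Greenberg, V. Vatsal, *On the Iwasawa invariants of elliptic curves*, Invent. Math. 142 (2000),
  (2)–(3) and Prop. (3.7).
* M. Emerton, R. Pollack, T. Weston, *Variation of Iwasawa invariants in Hida families*, Invent. Math. 163
  (2006), Def. 4.4.1 (unit content).
* L. C. Washington, *Introduction to cyclotomic fields*, GTM 83, §5.1, §7.2.
-/

noncomputable section

open Filter Topology
open scoped MatrixGroups ModularForm fwdDiff
open CongruenceSubgroup Literature.NumberTheory.EllipticCurves.ModularForms

namespace Literature.NumberTheory.EllipticCurves

variable {p : ℕ} [Fact p.Prime]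

/-! ### §0 Newton inversion of the level-`n` Riemann sums -/

section Newton

/-- Iterated forward differences of a function with values in the ball of radius `B` of `ℚ_p` stay in
that ball (`ℚ_p` is ultrametric). [folklore] -/
private theorem norm_fwdDiff_iter_le {g : ℕ → ℚ_[p]} {B : ℝ} (hg : ∀ x, ‖g x‖ ≤ B) (k x : ℕ) :
    ‖(Δ_[1])^[k] g x‖ ≤ B := by
  induction k generalizing x with
  | zero => simpa using hg x
  | succ k ih =>
    rw [Function.iterate_succ', Function.comp_apply]
    show ‖(Δ_[1])^[k] g (x + 1) - (Δ_[1])^[k] g x‖ ≤ B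
    calc ‖(Δ_[1])^[k] g (x + 1) - (Δ_[1])^[k] g x‖
        = ‖(Δ_[1])^[k] g (x + 1) + -(Δ_[1])^[k] g x‖ := by rw [sub_eq_add_neg]
      _ ≤ max ‖(Δ_[1])^[k] g (x + 1)‖ ‖-(Δ_[1])^[k] g x‖ := Padic.nonarchimedean _ _
      _ ≤ B := by rw [norm_neg]; exact max_le (ih _) (ih _)

/-- **Newton inversion below degree `pⁿ`.** If `ν : ℤ/pⁿ → ℚ_p` and all the "Riemann sums"
`R_k = ∑_s ν(s)·(s choose k)`, `k < pⁿ` (`s` represented in `[0, pⁿ)`), have norm `≤ B`, then every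
`ν(s)` has norm `≤ B`: by the Gregory–Newton formula the indicator of `s₀` on `[0, pⁿ)` is
`x ↦ ∑_{k ≤ x} (x choose k)·Δᵏ𝟙_{s₀}(0)` with INTEGER coefficients `Δᵏ𝟙_{s₀}(0)`, so
`ν(s₀) = ∑_{k < pⁿ} Δᵏ𝟙_{s₀}(0)·R_k` (Gregory–Newton interpolation). [folklore] -/
private theorem norm_le_of_forall_norm_sum_mul_choose_le {n : ℕ} (ν : ZMod (p ^ n) → ℚ_[p]) {B : ℝ}
    (hB : ∀ k < p ^ n, ‖∑ s : ZMod (p ^ n), ν s * ((s.val.choose k : ℕ) : ℚ_[p])‖ ≤ B)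
    (s₀ : ZMod (p ^ n)) : ‖ν s₀‖ ≤ B := by
  classical
  haveI : NeZero (p ^ n) := ⟨pow_ne_zero _ (Fact.out : p.Prime).ne_zero⟩
  have hB0 : 0 ≤ B := (norm_nonneg _).trans (hB 0 (pow_pos (Fact.out : p.Prime).pos n))
  -- the indicator of `s₀.val` on `ℕ` and its Newton coefficients
  set g : ℕ → ℚ_[p] := fun x ↦ if x = s₀.val then 1 else 0 with hg_def
  set b : ℕ → ℚ_[p] := fun k ↦ (Δ_[1])^[k] g 0 with hb_def
  have hg1 : ∀ x, ‖g x‖ ≤ 1 := fun x ↦ by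
    rw [hg_def]; dsimp only; split_ifs <;> simp
  have hb : ∀ k, ‖b k‖ ≤ 1 := fun k ↦ norm_fwdDiff_iter_le hg1 k 0
  -- Gregory–Newton: `g x = ∑_{k ≤ x} (x choose k) b_k`
  have hnewton : ∀ x : ℕ, g x = ∑ k ∈ Finset.range (x + 1), ((x.choose k : ℕ) : ℚ_[p]) * b k := by
    intro x
    have h := shift_eq_sum_fwdDiff_iter (1 : ℕ) g x 0
    rw [zero_add, smul_eq_mul, mul_one] at h
    rw [h]
    refine Finset.sum_congr rfl fun k _ ↦ ?_
    rw [hb_def, nsmul_eq_mul]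
  -- extend the Newton sum to `k < pⁿ` (the extra binomial coefficients vanish)
  have hnewton' : ∀ s : ZMod (p ^ n),
      g s.val = ∑ k ∈ Finset.range (p ^ n), ((s.val.choose k : ℕ) : ℚ_[p]) * b k := by
    intro s
    rw [hnewton s.val]
    refine Finset.sum_subset (Finset.range_mono (Nat.succ_le_of_lt (ZMod.val_lt s))) ?_
    intro k _ hk'
    rw [Finset.mem_range, not_lt] at hk'
    rw [Nat.choose_eq_zero_of_lt (Nat.lt_of_succ_le hk'), Nat.cast_zero, zero_mul]
  -- `ν s₀ = ∑_s ν(s) g(s) = ∑_k b_k R_k`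
  have hkey : ν s₀ = ∑ k ∈ Finset.range (p ^ n),
      b k * ∑ s : ZMod (p ^ n), ν s * ((s.val.choose k : ℕ) : ℚ_[p]) := by
    calc ν s₀ = ∑ s : ZMod (p ^ n), ν s * g s.val := by
          rw [Finset.sum_eq_single s₀]
          · rw [hg_def]; simp
          · intro s _ hs
            have : s.val ≠ s₀.val := fun h ↦ hs (ZMod.val_injective _ h)
            rw [hg_def]; simp [this]
          · intro h; exact absurd (Finset.mem_univ _) h
      _ = ∑ s : ZMod (p ^ n), ∑ k ∈ Finset.range (p ^ n),
            b k * (ν s * ((s.val.choose k : ℕ) : ℚ_[p])) := by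
          refine Finset.sum_congr rfl fun s _ ↦ ?_
          rw [hnewton' s, Finset.mul_sum]
          refine Finset.sum_congr rfl fun k _ ↦ ?_
          ring
      _ = _ := by
          rw [Finset.sum_comm]
          refine Finset.sum_congr rfl fun k _ ↦ ?_
          rw [Finset.mul_sum]
  rw [hkey]
  refine IsUltrametricDist.norm_sum_le_of_forall_le_of_nonneg hB0 fun k hk ↦ ?_
  rw [norm_mul]
  calc ‖b k‖ * ‖∑ s : ZMod (p ^ n), ν s * ((s.val.choose k : ℕ) : ℚ_[p])‖ ≤ 1 * B :=
        mul_le_mul (hb k) (hB k (Finset.mem_range.mp hk)) (norm_nonneg _) zero_le_one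
    _ = B := one_mul B

end Newton

/-! ### §1 Abstract: a unit orbit sum forces a unit coefficient below degree `pⁿ` -/

section Abstract

variable {μ : (n : ℕ) → ZMod (p ^ n) → ℚ_[p]} {RS : ℕ → ℕ → ℚ_[p]}
  (hRS : ∀ k n : ℕ, RS k n =
      ∑ᶠ ξ : rootsOfUnity (torsionOrder p) ℤ_[p], ∑ s : ZMod (p ^ n),
        μ (n + cyclotomicExponent p)
            (PadicInt.toZModPow (n + cyclotomicExponent p) ((ξ : ℤ_[p]ˣ) : ℤ_[p]) *
              (cyclotomicGenerator p : ZMod (p ^ (n + cyclotomicExponent p))) ^ s.val) *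
          ((s.val.choose k : ℕ) : ℚ_[p]))

include hRS

/-- The Riemann sum `RS(k, n)` regrouped by the `γ`-exponent: `RS(k,n) = ∑_{s mod pⁿ} ν_n(s)·(s choose k)`
with the **Teichmüller-orbit sums** `ν_n(s) = ∑_η μ(η γˢ + p^{n+e₀}ℤ_p)` — the values of the push-forward
of `μ|_{ℤ_p^×}` to the `γ`-exponent line, i.e. of the `ω⁰`-branch measure.
[cite: MazurTateTeitelbaum1986Invent, §I.13] -/
theorem riemannSum_eq_sum_orbitSum_mul_choose (k n : ℕ) :
    RS k n = ∑ s : ZMod (p ^ n), (∑ᶠ ξ : rootsOfUnity (torsionOrder p) ℤ_[p],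
        μ (n + cyclotomicExponent p)
          (PadicInt.toZModPow (n + cyclotomicExponent p) ((ξ : ℤ_[p]ˣ) : ℤ_[p]) *
            (cyclotomicGenerator p : ZMod (p ^ (n + cyclotomicExponent p))) ^ s.val)) *
        ((s.val.choose k : ℕ) : ℚ_[p]) := by
  classical
  haveI := neZero_torsionOrder p
  haveI := Fintype.ofFinite (rootsOfUnity (torsionOrder p) ℤ_[p])
  rw [hRS]
  simp only [finsum_eq_sum_of_fintype]
  rw [Finset.sum_comm]
  refine Finset.sum_congr rfl fun s _ ↦ ?_
  rw [Finset.sum_mul]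

/-- **`μ = 0` certificate, abstract form.** Let `μ` be a distribution on the tower `(ℤ/pⁿ)_n`
(`hdist`) bounded by `C` (`hC`), and `c_k = lim_m RS(k, m)` the coefficients of its Mazur–Tate–Teitelbaum
transform. If ONE Teichmüller-orbit sum at level `n` beats `C·p⁻¹`,
`C·p⁻¹ < ‖ν_n(s₀)‖ = ‖∑_η μ(η γ^{s₀} + p^{n+e₀}ℤ_p)‖`, then some coefficient `c_k` with `k < pⁿ` has
`C·p⁻¹ < ‖c_k‖`. Proof: otherwise all `c_k`, `k < pⁿ`, and hence (uniform congruence bound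
`‖c_k − RS(k,n)‖ ≤ C·p⁻¹` for `k < pⁿ`, Lucas) all `RS(k, n)`, `k < pⁿ`, lie in the ball of radius
`C·p⁻¹`; Newton inversion puts every `ν_n(s)` in that ball. For a `ℤ_p`-valued `μ` (`C = 1`) this reads:
«some `ν_n(s) ≢ 0 (mod p)` ⟹ some `c_k`, `k < pⁿ`, is a `p`-adic unit», i.e. `μ`-invariant zero.
[cite: MazurTateTeitelbaum1986Invent, §I.11–I.13] -/
theorem exists_lt_norm_limUnder_riemannSum_of_lt_norm_orbitSum
    (hdist : ∀ (n : ℕ) (a : ZMod (p ^ n)),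
      ∑ b ∈ Finset.univ.filter (fun b : ZMod (p ^ (n + 1)) ↦
        ZMod.castHom (pow_dvd_pow p n.le_succ) (ZMod (p ^ n)) b = a), μ (n + 1) b = μ n a)
    {C : ℝ} (hC : ∀ (n : ℕ) (a : ZMod (p ^ n)), ‖μ n a‖ ≤ C) {n : ℕ} {s₀ : ZMod (p ^ n)}
    (hs₀ : C * (p : ℝ)⁻¹ < ‖∑ᶠ ξ : rootsOfUnity (torsionOrder p) ℤ_[p],
        μ (n + cyclotomicExponent p)
          (PadicInt.toZModPow (n + cyclotomicExponent p) ((ξ : ℤ_[p]ˣ) : ℤ_[p]) *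
            (cyclotomicGenerator p : ZMod (p ^ (n + cyclotomicExponent p))) ^ s₀.val)‖) :
    ∃ k < p ^ n, C * (p : ℝ)⁻¹ < ‖limUnder atTop fun m ↦ RS k m‖ := by
  by_contra hcon
  push Not at hcon
  have hRSle : ∀ k < p ^ n, ‖RS k n‖ ≤ C * (p : ℝ)⁻¹ := fun k hk ↦ by
    have h1 := norm_limUnder_riemannSum_sub_le_mul_inv_of_lt_pow hRS hdist hC hk
    have h2 := hcon k hk
    calc ‖RS k n‖ = ‖(limUnder atTop fun m ↦ RS k m) +
          -((limUnder atTop fun m ↦ RS k m) - RS k n)‖ := by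
            congr 1; ring
      _ ≤ max ‖limUnder atTop fun m ↦ RS k m‖ ‖-((limUnder atTop fun m ↦ RS k m) - RS k n)‖ :=
            Padic.nonarchimedean _ _
      _ ≤ C * (p : ℝ)⁻¹ := by rw [norm_neg]; exact max_le h2 h1
  have hν := norm_le_of_forall_norm_sum_mul_choose_le
    (fun s : ZMod (p ^ n) ↦ ∑ᶠ ξ : rootsOfUnity (torsionOrder p) ℤ_[p],
        μ (n + cyclotomicExponent p)
          (PadicInt.toZModPow (n + cyclotomicExponent p) ((ξ : ℤ_[p]ˣ) : ℤ_[p]) *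
            (cyclotomicGenerator p : ZMod (p ^ (n + cyclotomicExponent p))) ^ s.val))
    (B := C * (p : ℝ)⁻¹) (fun k hk ↦ by
      rw [← riemannSum_eq_sum_orbitSum_mul_choose hRS k n]
      exact hRSle k hk) s₀
  exact absurd hs₀ (not_lt.mpr hν)

/-! ### §2 Abstract: the converse — orbit sums constant modulo `C·p⁻¹` force small coefficients -/

omit hRS in
/-- The orbit sums are bounded by the bound of `μ` (ultrametric). [folklore] -/
private theorem norm_orbitSum_le {C : ℝ} (hC : ∀ (n : ℕ) (a : ZMod (p ^ n)), ‖μ n a‖ ≤ C)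
    (n : ℕ) (s : ZMod (p ^ n)) :
    ‖∑ᶠ ξ : rootsOfUnity (torsionOrder p) ℤ_[p],
        μ (n + cyclotomicExponent p)
          (PadicInt.toZModPow (n + cyclotomicExponent p) ((ξ : ℤ_[p]ˣ) : ℤ_[p]) *
            (cyclotomicGenerator p : ZMod (p ^ (n + cyclotomicExponent p))) ^ s.val)‖ ≤ C := by
  classical
  haveI := neZero_torsionOrder p
  haveI := Fintype.ofFinite (rootsOfUnity (torsionOrder p) ℤ_[p])
  have hC0 : 0 ≤ C := (norm_nonneg _).trans (hC 0 0)
  rw [finsum_eq_sum_of_fintype]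
  exact IsUltrametricDist.norm_sum_le_of_forall_le_of_nonneg hC0 fun ξ _ ↦ hC _ _

omit hRS in
/-- **Distribution relation of the Teichmüller-orbit sums**: `∑_{s' ≡ s (pⁿ)} ν_{n+1}(s') = ν_n(s)`,
`ν_m(s) = ∑_η μ(η γˢ + p^{m+e₀}ℤ_p)` — the classes `η γ^{s'} mod p^{n+1+e₀}` with `s' ≡ s (mod pⁿ)` are
exactly the lifts of the class `η γˢ mod p^{n+e₀}` (`γ` has order `pⁿ` modulo `p^{n+e₀}`), so this is the
iterated distribution relation of `μ` grouped over units (`sum_units_mul_of_distribution`).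
[cite: MazurTateTeitelbaum1986Invent, §I.11–I.13] -/
theorem sum_fiber_orbitSum_succ_eq
    (hdist : ∀ (n : ℕ) (a : ZMod (p ^ n)),
      ∑ b ∈ Finset.univ.filter (fun b : ZMod (p ^ (n + 1)) ↦
        ZMod.castHom (pow_dvd_pow p n.le_succ) (ZMod (p ^ n)) b = a), μ (n + 1) b = μ n a)
    (n : ℕ) (s : ZMod (p ^ n)) :
    ∑ s' ∈ Finset.univ.filter (fun s' : ZMod (p ^ (n + 1)) ↦
        ZMod.castHom (pow_dvd_pow p n.le_succ) (ZMod (p ^ n)) s' = s),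
      (∑ᶠ ξ : rootsOfUnity (torsionOrder p) ℤ_[p],
        μ (n + 1 + cyclotomicExponent p)
          (PadicInt.toZModPow (n + 1 + cyclotomicExponent p) ((ξ : ℤ_[p]ˣ) : ℤ_[p]) *
            (cyclotomicGenerator p : ZMod (p ^ (n + 1 + cyclotomicExponent p))) ^ s'.val)) =
      ∑ᶠ ξ : rootsOfUnity (torsionOrder p) ℤ_[p],
        μ (n + cyclotomicExponent p)
          (PadicInt.toZModPow (n + cyclotomicExponent p) ((ξ : ℤ_[p]ˣ) : ℤ_[p]) *
            (cyclotomicGenerator p : ZMod (p ^ (n + cyclotomicExponent p))) ^ s.val) := by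
  classical
  haveI := neZero_torsionOrder p
  haveI := Fintype.ofFinite (rootsOfUnity (torsionOrder p) ℤ_[p])
  haveI : NeZero (p ^ n) := ⟨pow_ne_zero _ (Fact.out : p.Prime).ne_zero⟩
  haveI : NeZero (p ^ (n + 1)) := ⟨pow_ne_zero _ (Fact.out : p.Prime).ne_zero⟩
  -- the bijections `(ξ, s) ↦ ξ γ^s` at levels `n + e₀` and `n + 1 + e₀`
  set Φ : rootsOfUnity (torsionOrder p) ℤ_[p] × ZMod (p ^ n) →
      (ZMod (p ^ (n + cyclotomicExponent p)))ˣ := fun x ↦ (isUnit_classMap p n x).unit with hΦ_def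
  set Φ' : rootsOfUnity (torsionOrder p) ℤ_[p] × ZMod (p ^ (n + 1)) →
      (ZMod (p ^ (n + 1 + cyclotomicExponent p)))ˣ := fun x ↦ (isUnit_classMap p (n + 1) x).unit
    with hΦ'_def
  have hΦval : ∀ x, (Φ x : ZMod (p ^ (n + cyclotomicExponent p))) =
      PadicInt.toZModPow (n + cyclotomicExponent p) ((x.1 : ℤ_[p]ˣ) : ℤ_[p]) *
        (cyclotomicGenerator p : ZMod (p ^ (n + cyclotomicExponent p))) ^ x.2.val := fun x ↦
    IsUnit.unit_spec _
  have hΦ'val : ∀ x, (Φ' x : ZMod (p ^ (n + 1 + cyclotomicExponent p))) =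
      PadicInt.toZModPow (n + 1 + cyclotomicExponent p) ((x.1 : ℤ_[p]ˣ) : ℤ_[p]) *
        (cyclotomicGenerator p : ZMod (p ^ (n + 1 + cyclotomicExponent p))) ^ x.2.val := fun x ↦
    IsUnit.unit_spec _
  have hΦinj : Function.Injective Φ := fun x y hxy ↦ classMap_injective p n (by
    have h := congr_arg Units.val hxy
    rwa [hΦval, hΦval] at h)
  have hΦ'inj : Function.Injective Φ' := fun x y hxy ↦ classMap_injective p (n + 1) (by
    have h := congr_arg Units.val hxy
    rwa [hΦ'val, hΦ'val] at h)
  have hΦbij : Function.Bijective Φ :=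
    (Fintype.bijective_iff_injective_and_card Φ).mpr ⟨hΦinj, card_classDomain p n⟩
  have hΦ'bij : Function.Bijective Φ' :=
    (Fintype.bijective_iff_injective_and_card Φ').mpr ⟨hΦ'inj, card_classDomain p (n + 1)⟩
  set E := Equiv.ofBijective Φ hΦbij with hE_def
  set E' := Equiv.ofBijective Φ' hΦ'bij with hE'_def
  -- the indicator of «`γ`-exponent `≡ s (mod pⁿ)`», extended by `0` to non-units
  set G : ZMod (p ^ (n + cyclotomicExponent p)) → ℚ_[p] := fun b ↦
    if h : IsUnit b then (if (E.symm h.unit).2 = s then 1 else 0) else 0 with hG_def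
  set G' : ZMod (p ^ (n + 1 + cyclotomicExponent p)) → ℚ_[p] := fun b ↦
    if h : IsUnit b then
      (if ZMod.castHom (pow_dvd_pow p n.le_succ) (ZMod (p ^ n)) (E'.symm h.unit).2 = s then 1
        else 0) else 0 with hG'_def
  have hGΦ : ∀ x, G (Φ x) = if x.2 = s then 1 else 0 := by
    intro x
    rw [hG_def]
    dsimp only
    rw [dif_pos (Units.isUnit _), IsUnit.unit_of_val_units]
    simp [hE_def]
  have hG'Φ' : ∀ x, G' (Φ' x) =
      if ZMod.castHom (pow_dvd_pow p n.le_succ) (ZMod (p ^ n)) x.2 = s then 1 else 0 := by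
    intro x
    rw [hG'_def]
    dsimp only
    rw [dif_pos (Units.isUnit _), IsUnit.unit_of_val_units]
    simp [hE'_def]
  -- right-hand side as a sum over the units of level `n + e₀`
  have hR : (∑ᶠ ξ : rootsOfUnity (torsionOrder p) ℤ_[p],
        μ (n + cyclotomicExponent p)
          (PadicInt.toZModPow (n + cyclotomicExponent p) ((ξ : ℤ_[p]ˣ) : ℤ_[p]) *
            (cyclotomicGenerator p : ZMod (p ^ (n + cyclotomicExponent p))) ^ s.val)) =
      ∑ u : (ZMod (p ^ (n + cyclotomicExponent p)))ˣ, μ (n + cyclotomicExponent p) u * G u := by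
    rw [← finsum_sum_classes_eq_sum_units p n (fun b ↦ μ (n + cyclotomicExponent p) b * G b)]
    refine finsum_congr fun ξ ↦ ?_
    have hterm : ∀ s'' : ZMod (p ^ n),
        μ (n + cyclotomicExponent p)
            (PadicInt.toZModPow (n + cyclotomicExponent p) ((ξ : ℤ_[p]ˣ) : ℤ_[p]) *
              (cyclotomicGenerator p : ZMod (p ^ (n + cyclotomicExponent p))) ^ s''.val) *
          G (PadicInt.toZModPow (n + cyclotomicExponent p) ((ξ : ℤ_[p]ˣ) : ℤ_[p]) *
              (cyclotomicGenerator p : ZMod (p ^ (n + cyclotomicExponent p))) ^ s''.val) =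
        if s'' = s then μ (n + cyclotomicExponent p)
            (PadicInt.toZModPow (n + cyclotomicExponent p) ((ξ : ℤ_[p]ˣ) : ℤ_[p]) *
              (cyclotomicGenerator p : ZMod (p ^ (n + cyclotomicExponent p))) ^ s''.val) else 0 := by
      intro s''
      rw [← hΦval (ξ, s''), hGΦ]
      split_ifs <;> simp
    rw [Finset.sum_congr rfl fun s'' _ ↦ hterm s'', Finset.sum_ite_eq' Finset.univ s,
      if_pos (Finset.mem_univ _)]
  -- left-hand side as a sum over the units of level `n + 1 + e₀`
  have hL : (∑ s' ∈ Finset.univ.filter (fun s' : ZMod (p ^ (n + 1)) ↦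
        ZMod.castHom (pow_dvd_pow p n.le_succ) (ZMod (p ^ n)) s' = s),
      (∑ᶠ ξ : rootsOfUnity (torsionOrder p) ℤ_[p],
        μ (n + 1 + cyclotomicExponent p)
          (PadicInt.toZModPow (n + 1 + cyclotomicExponent p) ((ξ : ℤ_[p]ˣ) : ℤ_[p]) *
            (cyclotomicGenerator p : ZMod (p ^ (n + 1 + cyclotomicExponent p))) ^ s'.val))) =
      ∑ u' : (ZMod (p ^ (n + 1 + cyclotomicExponent p)))ˣ,
        μ (n + 1 + cyclotomicExponent p) u' * G' u' := by
    rw [← finsum_sum_classes_eq_sum_units p (n + 1)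
      (fun b ↦ μ (n + 1 + cyclotomicExponent p) b * G' b)]
    simp only [finsum_eq_sum_of_fintype]
    rw [Finset.sum_comm]
    refine Finset.sum_congr rfl fun ξ _ ↦ ?_
    rw [Finset.sum_filter]
    refine Finset.sum_congr rfl fun s' _ ↦ ?_
    rw [← hΦ'val (ξ, s'), hG'Φ']
    split_ifs <;> simp
  -- `G' = G ∘ cast` on units
  have hle : n + cyclotomicExponent p ≤ n + 1 + cyclotomicExponent p := by omega
  have hG'G : ∀ u' : (ZMod (p ^ (n + 1 + cyclotomicExponent p)))ˣ,
      G' u' = G (ZMod.castHom (pow_dvd_pow p hle) (ZMod (p ^ (n + cyclotomicExponent p))) u') := by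
    intro u'
    obtain ⟨⟨θ, s'⟩, hx'⟩ := hΦ'bij.2 u'
    have hpow : (cyclotomicGenerator p : ZMod (p ^ (n + cyclotomicExponent p))) ^ (s'.val % p ^ n) =
        (cyclotomicGenerator p : ZMod (p ^ (n + cyclotomicExponent p))) ^ s'.val := by
      have h := pow_mod_orderOf (cyclotomicGenerator p : ZMod (p ^ (n + cyclotomicExponent p)))
        s'.val
      rwa [orderOf_cyclotomicGenerator p n] at h
    have hcast : (ZMod.castHom (pow_dvd_pow p hle) (ZMod (p ^ (n + cyclotomicExponent p))) u' :
        ZMod (p ^ (n + cyclotomicExponent p))) = Φ (θ, (s'.val : ZMod (p ^ n))) := by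
      rw [hΦval, ← hx', hΦ'val]
      dsimp only
      rw [map_mul, map_pow,
        map_natCast (ZMod.castHom (pow_dvd_pow p hle) (ZMod (p ^ (n + cyclotomicExponent p)))),
        ZMod.castHom_apply, PadicInt.cast_toZModPow _ _ hle, ZMod.val_natCast, hpow]
    have hG'u : G' u' = if ZMod.castHom (pow_dvd_pow p n.le_succ) (ZMod (p ^ n)) s' = s
        then 1 else 0 := by rw [← hx', hG'Φ']
    have hGu : G (ZMod.castHom (pow_dvd_pow p hle) (ZMod (p ^ (n + cyclotomicExponent p))) u') =
        if (s'.val : ZMod (p ^ n)) = s then 1 else 0 := by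
      rw [hcast, hGΦ]
    have hs' : ZMod.castHom (pow_dvd_pow p n.le_succ) (ZMod (p ^ n)) s' = (s'.val : ZMod (p ^ n)) := by
      rw [ZMod.castHom_apply, ZMod.cast_eq_val]
    rw [hG'u, hGu, hs']
  rw [hL, hR, Finset.sum_congr rfl fun u' _ ↦ by rw [hG'G u']]
  have hm : 1 ≤ n + cyclotomicExponent p :=
    le_add_of_le_right (Nat.pos_of_ne_zero (cyclotomicExponent_ne_zero p))
  have hdesc := sum_units_mul_of_distribution hdist (RingHom.id ℚ_[p])
    (m := n + cyclotomicExponent p) (L := n + 1 + cyclotomicExponent p) hm hle G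
  simp only [RingHom.id_apply] at hdesc
  exact hdesc

omit hRS in
/-- **All orbit sums lie in the ball `C·p⁻¹` as soon as, at every level, they are CONGRUENT to one
another modulo that ball**: `ν_n(s) = ∑_{s' ≡ s} ν_{n+1}(s')` is a sum of `p` terms each within `C·p⁻¹`
of `ν_{n+1}(s₁)`, and `‖p·ν_{n+1}(s₁)‖ ≤ p⁻¹·C`. [cite: MazurTateTeitelbaum1986Invent, §I.11] -/
theorem norm_orbitSum_le_of_forall_norm_sub_le
    (hdist : ∀ (n : ℕ) (a : ZMod (p ^ n)),
      ∑ b ∈ Finset.univ.filter (fun b : ZMod (p ^ (n + 1)) ↦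
        ZMod.castHom (pow_dvd_pow p n.le_succ) (ZMod (p ^ n)) b = a), μ (n + 1) b = μ n a)
    {C : ℝ} (hC : ∀ (n : ℕ) (a : ZMod (p ^ n)), ‖μ n a‖ ≤ C)
    (hconst : ∀ (n : ℕ) (s s' : ZMod (p ^ n)),
      ‖(∑ᶠ ξ : rootsOfUnity (torsionOrder p) ℤ_[p],
          μ (n + cyclotomicExponent p)
            (PadicInt.toZModPow (n + cyclotomicExponent p) ((ξ : ℤ_[p]ˣ) : ℤ_[p]) *
              (cyclotomicGenerator p : ZMod (p ^ (n + cyclotomicExponent p))) ^ s.val)) -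
        (∑ᶠ ξ : rootsOfUnity (torsionOrder p) ℤ_[p],
          μ (n + cyclotomicExponent p)
            (PadicInt.toZModPow (n + cyclotomicExponent p) ((ξ : ℤ_[p]ˣ) : ℤ_[p]) *
              (cyclotomicGenerator p : ZMod (p ^ (n + cyclotomicExponent p))) ^ s'.val))‖ ≤
        C * (p : ℝ)⁻¹)
    (n : ℕ) (s : ZMod (p ^ n)) :
    ‖∑ᶠ ξ : rootsOfUnity (torsionOrder p) ℤ_[p],
        μ (n + cyclotomicExponent p)
          (PadicInt.toZModPow (n + cyclotomicExponent p) ((ξ : ℤ_[p]ˣ) : ℤ_[p]) *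
            (cyclotomicGenerator p : ZMod (p ^ (n + cyclotomicExponent p))) ^ s.val)‖ ≤
      C * (p : ℝ)⁻¹ := by
  classical
  haveI : NeZero (p ^ n) := ⟨pow_ne_zero _ (Fact.out : p.Prime).ne_zero⟩
  haveI : NeZero (p ^ (n + 1)) := ⟨pow_ne_zero _ (Fact.out : p.Prime).ne_zero⟩
  have hp : p.Prime := Fact.out
  have hC0 : 0 ≤ C := (norm_nonneg _).trans (hC 0 0)
  -- abbreviation for the orbit sums at level `n + 1`
  set ν' : ZMod (p ^ (n + 1)) → ℚ_[p] := fun s' ↦ ∑ᶠ ξ : rootsOfUnity (torsionOrder p) ℤ_[p],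
        μ (n + 1 + cyclotomicExponent p)
          (PadicInt.toZModPow (n + 1 + cyclotomicExponent p) ((ξ : ℤ_[p]ˣ) : ℤ_[p]) *
            (cyclotomicGenerator p : ZMod (p ^ (n + 1 + cyclotomicExponent p))) ^ s'.val)
    with hν'_def
  rw [← sum_fiber_orbitSum_succ_eq hdist n s]
  -- the fibre of `s` and a base point `s₁` in it
  set F := Finset.univ.filter (fun s' : ZMod (p ^ (n + 1)) ↦
        ZMod.castHom (pow_dvd_pow p n.le_succ) (ZMod (p ^ n)) s' = s) with hF_def
  set s₁ : ZMod (p ^ (n + 1)) := (s.val : ZMod (p ^ (n + 1))) with hs₁_def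
  have hs₁F : s₁ ∈ F := by
    rw [hF_def, Finset.mem_filter]
    refine ⟨Finset.mem_univ _, ?_⟩
    rw [hs₁_def, map_natCast, ZMod.natCast_zmod_val]
  -- `#F = p`
  have hcardF : F.card = p := by
    rw [hF_def, filter_castHom_eq_image (p := p) n s, Finset.card_image_of_injective _ ?_]
    · rw [Finset.card_univ, Fintype.card_fin]
    · intro j j' hjj'
      have h := congr_arg ZMod.val hjj'
      dsimp only at h
      rw [val_classLift, val_classLift] at h
      exact Fin.ext (Nat.eq_of_mul_eq_mul_left (pow_pos hp.pos n) (by omega))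
  -- decompose
  have hsum : ∑ s' ∈ F, ν' s' = ∑ s' ∈ F, (ν' s' - ν' s₁) + (p : ℚ_[p]) * ν' s₁ := by
    rw [Finset.sum_sub_distrib, Finset.sum_const, hcardF, nsmul_eq_mul, sub_add_cancel]
  show ‖∑ s' ∈ F, ν' s'‖ ≤ C * (p : ℝ)⁻¹
  rw [hsum]
  have h1 : ‖∑ s' ∈ F, (ν' s' - ν' s₁)‖ ≤ C * (p : ℝ)⁻¹ :=
    IsUltrametricDist.norm_sum_le_of_forall_le_of_nonneg (mul_nonneg hC0 (by positivity))
      fun s' _ ↦ hconst (n + 1) s' s₁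
  have h2 : ‖(p : ℚ_[p]) * ν' s₁‖ ≤ C * (p : ℝ)⁻¹ := by
    rw [norm_mul, Padic.norm_p, mul_comm]
    refine mul_le_mul_of_nonneg_right ?_ (by positivity)
    rw [hν'_def]
    exact norm_orbitSum_le hC (n + 1) s₁
  calc _ ≤ max ‖∑ s' ∈ F, (ν' s' - ν' s₁)‖ ‖(p : ℚ_[p]) * ν' s₁‖ := Padic.nonarchimedean _ _
    _ ≤ C * (p : ℝ)⁻¹ := max_le h1 h2

/-- **Converse certificate, abstract form.** If at EVERY level the Teichmüller-orbit sums are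
congruent to one another modulo the ball `C·p⁻¹` (`‖ν_n(s) − ν_n(s')‖ ≤ C·p⁻¹` for all `n, s, s'`), then
every coefficient of the transform has `‖c_k‖ ≤ C·p⁻¹`: all `ν_n(s)` lie in that ball
(`norm_orbitSum_le_of_forall_norm_sub_le`), hence so do the Riemann sums `RS(k,n) = ∑_s ν_n(s)(s choose k)`
and their limits. For a `ℤ_p`-valued `μ`: «orbit sums constant mod `p` at every level ⟹ NO coefficient is
a unit», i.e. positive `μ`-invariant. [cite: MazurTateTeitelbaum1986Invent, §I.11–I.13] -/
theorem norm_limUnder_riemannSum_le_of_forall_norm_orbitSum_sub_le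
    (hdist : ∀ (n : ℕ) (a : ZMod (p ^ n)),
      ∑ b ∈ Finset.univ.filter (fun b : ZMod (p ^ (n + 1)) ↦
        ZMod.castHom (pow_dvd_pow p n.le_succ) (ZMod (p ^ n)) b = a), μ (n + 1) b = μ n a)
    {C : ℝ} (hC : ∀ (n : ℕ) (a : ZMod (p ^ n)), ‖μ n a‖ ≤ C)
    (hconst : ∀ (n : ℕ) (s s' : ZMod (p ^ n)),
      ‖(∑ᶠ ξ : rootsOfUnity (torsionOrder p) ℤ_[p],
          μ (n + cyclotomicExponent p)
            (PadicInt.toZModPow (n + cyclotomicExponent p) ((ξ : ℤ_[p]ˣ) : ℤ_[p]) *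
              (cyclotomicGenerator p : ZMod (p ^ (n + cyclotomicExponent p))) ^ s.val)) -
        (∑ᶠ ξ : rootsOfUnity (torsionOrder p) ℤ_[p],
          μ (n + cyclotomicExponent p)
            (PadicInt.toZModPow (n + cyclotomicExponent p) ((ξ : ℤ_[p]ˣ) : ℤ_[p]) *
              (cyclotomicGenerator p : ZMod (p ^ (n + cyclotomicExponent p))) ^ s'.val))‖ ≤
        C * (p : ℝ)⁻¹)
    (k : ℕ) : ‖limUnder atTop fun m ↦ RS k m‖ ≤ C * (p : ℝ)⁻¹ := by
  classical
  have hC0 : 0 ≤ C := (norm_nonneg _).trans (hC 0 0)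
  have hν := norm_orbitSum_le_of_forall_norm_sub_le (μ := μ) hdist hC hconst
  have hRSle : ∀ m, ‖RS k m‖ ≤ C * (p : ℝ)⁻¹ := fun m ↦ by
    haveI : NeZero (p ^ m) := ⟨pow_ne_zero _ (Fact.out : p.Prime).ne_zero⟩
    rw [riemannSum_eq_sum_orbitSum_mul_choose hRS k m]
    refine IsUltrametricDist.norm_sum_le_of_forall_le_of_nonneg (mul_nonneg hC0 (by positivity))
      fun s _ ↦ ?_
    have hchoose : ‖((s.val.choose k : ℕ) : ℚ_[p])‖ ≤ 1 := by
      have h := Padic.norm_int_le_one (p := p) ((s.val.choose k : ℕ) : ℤ)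
      rwa [Int.cast_natCast] at h
    rw [norm_mul]
    calc _ ≤ C * (p : ℝ)⁻¹ * 1 := mul_le_mul (hν m s) hchoose (norm_nonneg _)
          (mul_nonneg hC0 (by positivity))
      _ = _ := mul_one _
  exact le_of_tendsto (tendsto_riemannSum_of_distribution hRS hdist hC k).norm
    (Eventually.of_forall hRSle)

end Abstract

/-! ### §3 Odd `p`: Teichmüller representatives modulo `p^m` and the orbit sums of `μ_{f,α}` -/

section OddPrime

omit [Fact p.Prime] in
variable (p) in
/-- `e₀ = 1` for odd `p`. [folklore] -/
private theorem cyclotomicExponent_eq_one (hp2 : p ≠ 2) : cyclotomicExponent p = 1 := by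
  unfold cyclotomicExponent
  exact if_neg hp2

variable (p) in
/-- `τ = p − 1` for odd `p`. [folklore] -/
private theorem torsionOrder_eq_sub_one (hp2 : p ≠ 2) : torsionOrder p = p - 1 := by
  rw [torsionOrder_eq, if_neg hp2]

variable (p) in
/-- For odd `p`, reduction modulo `p^m`, `m ≥ 1`, is injective on the Teichmüller representatives
`μ_{p−1}(ℤ_p)` (they are already distinct modulo `p`) (Washington, *Cyclotomic fields*, §5.1: the Teichmüller
character). [cite: Washington1997, §5.1 (Teichmüller character ω)] -/
theorem toZModPow_rootsOfUnity_injective_of_le (hp2 : p ≠ 2) {m : ℕ} (hm : 1 ≤ m) :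
    Function.Injective fun ξ : rootsOfUnity (torsionOrder p) ℤ_[p] ↦
      PadicInt.toZModPow m ((ξ : ℤ_[p]ˣ) : ℤ_[p]) := by
  intro ξ ξ' h
  apply toZModPow_rootsOfUnity_injective p
  have hle : cyclotomicExponent p ≤ m := by rw [cyclotomicExponent_eq_one p hp2]; exact hm
  dsimp only at h ⊢
  have h' := congr_arg (ZMod.castHom (pow_dvd_pow p hle) (ZMod (p ^ cyclotomicExponent p))) h
  simpa only [ZMod.castHom_apply, PadicInt.cast_toZModPow _ _ hle] using h'

variable (p) in
/-- **Teichmüller representatives modulo `p^m` (`p` odd, `m ≥ 1`) are exactly the solutions of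
`t^{p−1} = 1` in `ℤ/p^m`**: the `p − 1` reductions of `μ_{p−1}(ℤ_p)` are distinct solutions, and a
cyclic group (`(ℤ/p^m)^×`, `p` odd) has at most `p − 1` elements of order dividing `p − 1`.
(Washington, *Cyclotomic fields*, §5.1: `ω(a)` is the unique `(p−1)`-st root of unity `≡ a`; Serre, *Cours
d'arithmétique* II.3). [cite: Washington1997, §5.1 (Teichmüller character ω)] -/
theorem image_toZModPow_rootsOfUnity_eq_filter (hp2 : p ≠ 2) {m : ℕ} (hm : 1 ≤ m)
    [Fintype (rootsOfUnity (torsionOrder p) ℤ_[p])] [DecidableEq (ZMod (p ^ m))] :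
    Finset.univ.image (fun ξ : rootsOfUnity (torsionOrder p) ℤ_[p] ↦
        PadicInt.toZModPow m ((ξ : ℤ_[p]ˣ) : ℤ_[p])) =
      Finset.univ.filter (fun t : ZMod (p ^ m) ↦ t ^ (p - 1) = 1) := by
  classical
  haveI : NeZero (p ^ m) := ⟨pow_ne_zero _ (Fact.out : p.Prime).ne_zero⟩
  have hp : p.Prime := Fact.out
  have hp1 : 0 < p - 1 := by have := hp.two_le; omega
  have hτ := torsionOrder_eq_sub_one p hp2
  -- image ⊆ filter
  have hsub : Finset.univ.image (fun ξ : rootsOfUnity (torsionOrder p) ℤ_[p] ↦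
        PadicInt.toZModPow m ((ξ : ℤ_[p]ˣ) : ℤ_[p])) ⊆
      Finset.univ.filter (fun t : ZMod (p ^ m) ↦ t ^ (p - 1) = 1) := by
    intro t ht
    rw [Finset.mem_image] at ht
    obtain ⟨ξ, -, rfl⟩ := ht
    rw [Finset.mem_filter]
    refine ⟨Finset.mem_univ _, ?_⟩
    rw [← map_pow, ← hτ, rootsOfUnity_pow_torsionOrder p ξ, map_one]
  -- the image has `p − 1` elements
  have hcard_image : (Finset.univ.image (fun ξ : rootsOfUnity (torsionOrder p) ℤ_[p] ↦
        PadicInt.toZModPow m ((ξ : ℤ_[p]ˣ) : ℤ_[p]))).card = p - 1 := by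
    rw [Finset.card_image_of_injective _ (toZModPow_rootsOfUnity_injective_of_le p hp2 hm),
      Finset.card_univ, ← Nat.card_eq_fintype_card, card_rootsOfUnity_torsionOrder, hτ]
  -- the filter has at most `p − 1` elements: inject it into the `(p−1)`-torsion of the cyclic `(ℤ/p^m)^×`
  have hcard_filter : (Finset.univ.filter (fun t : ZMod (p ^ m) ↦ t ^ (p - 1) = 1)).card ≤ p - 1 := by
    haveI : IsCyclic (ZMod (p ^ m))ˣ := ZMod.isCyclic_units_of_prime_pow p hp hp2 m
    have hcyc := IsCyclic.card_pow_eq_one_le (α := (ZMod (p ^ m))ˣ) hp1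
    refine le_trans ?_ hcyc
    refine Finset.card_le_card_of_injOn (fun t ↦ if h : IsUnit t then h.unit else 1) ?_ ?_
    · intro t ht
      have ht' : t ^ (p - 1) = 1 := (Finset.mem_filter.mp (Finset.mem_coe.mp ht)).2
      have hu : IsUnit t := IsUnit.of_pow_eq_one ht' hp1.ne'
      simp only [Finset.coe_filter, Finset.mem_univ, true_and, Set.mem_setOf_eq, dif_pos hu]
      ext
      rw [Units.val_pow_eq_pow_val, IsUnit.unit_spec, ht', Units.val_one]
    · intro t ht t' ht' h
      have htu : IsUnit t :=
        IsUnit.of_pow_eq_one (Finset.mem_filter.mp (Finset.mem_coe.mp ht)).2 hp1.ne'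
      have htu' : IsUnit t' :=
        IsUnit.of_pow_eq_one (Finset.mem_filter.mp (Finset.mem_coe.mp ht')).2 hp1.ne'
      simp only [dif_pos htu, dif_pos htu'] at h
      rw [← htu.unit_spec, ← htu'.unit_spec, h]
  exact Finset.eq_of_subset_of_card_le hsub (by rw [hcard_image]; exact hcard_filter)

variable {N : ℕ} (f : CuspForm (Gamma0 N) 2)

/-- **The Teichmüller-orbit sum of plus symbols as a sum over `μ_{p−1}(ℤ_p)`** (`p` odd, `m ≥ 1`):
`S_f(p,m,a) = ∑_{t^{p−1} = 1} [t a/p^m]⁺_f = ∑_{η ∈ μ_{p−1}(ℤ_p)} [η̄ a/p^m]⁺_f`.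
[cite: MazurTateTeitelbaum1986Invent, §I.10 (10.1)] -/
theorem teichOrbitSum_eq_finsum (hp2 : p ≠ 2) {m : ℕ} (hm : 1 ≤ m) (a : ZMod (p ^ m)) :
    Rank1Residual.teichOrbitSum f p m a = ∑ᶠ ξ : rootsOfUnity (torsionOrder p) ℤ_[p],
      ratPlusSymbol f ((((PadicInt.toZModPow m ((ξ : ℤ_[p]ˣ) : ℤ_[p])) * a).val : ℚ) /
        (p : ℚ) ^ m) := by
  classical
  haveI := neZero_torsionOrder p
  haveI := Fintype.ofFinite (rootsOfUnity (torsionOrder p) ℤ_[p])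
  rw [Rank1Residual.teichOrbitSum_def, finsum_eq_sum_of_fintype,
    ← image_toZModPow_rootsOfUnity_eq_filter p hp2 hm,
    Finset.sum_image fun ξ _ ξ' _ h ↦ toZModPow_rootsOfUnity_injective_of_le p hp2 hm h]

/-- The sum over `μ_{p−1}(ℤ_p)` is invariant under multiplying `a` by a Teichmüller representative
(reindex `η ↦ η η₀`). [folklore] -/
private theorem finsum_ratPlusSymbol_mul_toZModPow (m : ℕ) (ξ₀ : rootsOfUnity (torsionOrder p) ℤ_[p])
    (a : ZMod (p ^ m)) :
    (∑ᶠ ξ : rootsOfUnity (torsionOrder p) ℤ_[p],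
      ratPlusSymbol f ((((PadicInt.toZModPow m ((ξ : ℤ_[p]ˣ) : ℤ_[p])) *
        (PadicInt.toZModPow m ((ξ₀ : ℤ_[p]ˣ) : ℤ_[p]) * a)).val : ℚ) / (p : ℚ) ^ m)) =
      ∑ᶠ ξ : rootsOfUnity (torsionOrder p) ℤ_[p],
        ratPlusSymbol f ((((PadicInt.toZModPow m ((ξ : ℤ_[p]ˣ) : ℤ_[p])) * a).val : ℚ) /
          (p : ℚ) ^ m) := by
  classical
  haveI := neZero_torsionOrder p
  haveI := Fintype.ofFinite (rootsOfUnity (torsionOrder p) ℤ_[p])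
  rw [finsum_eq_sum_of_fintype, finsum_eq_sum_of_fintype]
  refine Fintype.sum_equiv (Equiv.mulRight ξ₀) _ _ fun ξ ↦ ?_
  simp only [Equiv.coe_mulRight, Subgroup.coe_mul, Units.val_mul, map_mul, mul_assoc]

/-- Reducing the numerator modulo `pⁿ` does not change `[x/pⁿ]⁺` (`[r + 1]⁺ = [r]⁺`): for
`x ∈ ℤ/p^{n+1}`, `[x.val/pⁿ]⁺_f = [(x mod pⁿ).val/pⁿ]⁺_f`. [cite: MazurTateTeitelbaum1986Invent, §I.4 (4.2)] -/
theorem ratPlusSymbol_val_div_pow_eq_castHom [NeZero N] (n : ℕ) (x : ZMod (p ^ (n + 1))) :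
    ratPlusSymbol f ((x.val : ℚ) / (p : ℚ) ^ n) =
      ratPlusSymbol f ((((ZMod.castHom (pow_dvd_pow p n.le_succ) (ZMod (p ^ n)) x).val : ℚ)) /
        (p : ℚ) ^ n) := by
  haveI : NeZero (p ^ n) := ⟨pow_ne_zero _ (Fact.out : p.Prime).ne_zero⟩
  have hp0 : (p : ℚ) ^ n ≠ 0 := pow_ne_zero _ (Nat.cast_ne_zero.mpr (Fact.out : p.Prime).ne_zero)
  have hval : (ZMod.castHom (pow_dvd_pow p n.le_succ) (ZMod (p ^ n)) x).val = x.val % p ^ n := by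
    rw [ZMod.castHom_apply, ZMod.cast_eq_val, ZMod.val_natCast]
  rw [hval]
  have hdecomp : (x.val : ℚ) / (p : ℚ) ^ n =
      ((x.val % p ^ n : ℕ) : ℚ) / (p : ℚ) ^ n + ((x.val / p ^ n : ℕ) : ℤ) := by
    have h := Nat.mod_add_div x.val (p ^ n)
    rw [Int.cast_natCast]
    field_simp
    exact_mod_cast h.symm
  rw [hdecomp, ratPlusSymbol_add_intCast_eq]

variable {f} {α : ℚ_[p]}

/-- **The orbit sums of `μ_{f,α}` in symbol currency** (`p` odd, `n ≥ 1`, MTT (10.1) summed over the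
Teichmüller orbit): with `T_m(a) = ∑_η [η̄ a/p^m]⁺_f`,
`ν_n(s) = ∑_η μ_{f,α}(η γˢ + p^{n+1}ℤ_p) = α^{−(n+1)} T_{n+1}(γˢ) − α^{−(n+2)} T_n(γˢ)`.
[cite: MazurTateTeitelbaum1986Invent, §I.10 (10.1)] -/
theorem finsum_msdMeasure_orbit_eq [NeZero N] (hp2 : p ≠ 2) {n : ℕ} (s : ZMod (p ^ n)) :
    (∑ᶠ ξ : rootsOfUnity (torsionOrder p) ℤ_[p],
        msdMeasure f α (n + cyclotomicExponent p)
          (PadicInt.toZModPow (n + cyclotomicExponent p) ((ξ : ℤ_[p]ˣ) : ℤ_[p]) *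
            (cyclotomicGenerator p : ZMod (p ^ (n + cyclotomicExponent p))) ^ s.val)) =
      α⁻¹ ^ (n + 1) * ((∑ᶠ ξ : rootsOfUnity (torsionOrder p) ℤ_[p],
        ratPlusSymbol f ((((PadicInt.toZModPow (n + 1) ((ξ : ℤ_[p]ˣ) : ℤ_[p])) *
          (cyclotomicGenerator p : ZMod (p ^ (n + 1))) ^ s.val).val : ℚ) / (p : ℚ) ^ (n + 1)) : ℚ) :
            ℚ_[p]) -
      α⁻¹ ^ (n + 2) * ((∑ᶠ ξ : rootsOfUnity (torsionOrder p) ℤ_[p],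
        ratPlusSymbol f ((((PadicInt.toZModPow n ((ξ : ℤ_[p]ˣ) : ℤ_[p])) *
          (cyclotomicGenerator p : ZMod (p ^ n)) ^ s.val).val : ℚ) / (p : ℚ) ^ n) : ℚ) : ℚ_[p]) := by
  classical
  haveI := neZero_torsionOrder p
  haveI := Fintype.ofFinite (rootsOfUnity (torsionOrder p) ℤ_[p])
  have he := cyclotomicExponent_eq_one p hp2
  rw [he]
  simp only [finsum_eq_sum_of_fintype, msdMeasure]
  rw [Finset.sum_sub_distrib]
  push_cast
  rw [Finset.mul_sum, Finset.mul_sum]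
  congr 1
  refine Finset.sum_congr rfl fun ξ _ ↦ ?_
  rw [ratPlusSymbol_val_div_pow_eq_castHom f n, map_mul, map_pow, map_natCast,
    ZMod.castHom_apply, PadicInt.cast_toZModPow _ _ n.le_succ]

/-- For odd `p`, every unit of `ℤ/p^{m+1}` is `η̄ γˢ` for a Teichmüller representative `η` and some
`s mod p^m` (`ℤ_p^× = μ_{p−1} × (1+pℤ_p)`, `1 + pℤ_p = γ^{ℤ_p}`; the classes `η γˢ` exhaust the units,
`card_classDomain`; Washington, *Cyclotomic fields*, §7.2). [cite: Washington1997, §7.2 (ℤ_p^× = μ_{p−1} × (1 + pℤ_p))] -/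
theorem exists_coe_eq_toZModPow_mul_pow (hp2 : p ≠ 2) (m : ℕ) (a : (ZMod (p ^ (m + 1)))ˣ) :
    ∃ (ξ : rootsOfUnity (torsionOrder p) ℤ_[p]) (s : ZMod (p ^ m)),
      (a : ZMod (p ^ (m + 1))) = PadicInt.toZModPow (m + 1) ((ξ : ℤ_[p]ˣ) : ℤ_[p]) *
        (cyclotomicGenerator p : ZMod (p ^ (m + 1))) ^ s.val := by
  classical
  haveI := neZero_torsionOrder p
  haveI := Fintype.ofFinite (rootsOfUnity (torsionOrder p) ℤ_[p])
  have key : ∀ b : (ZMod (p ^ (m + cyclotomicExponent p)))ˣ,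
      ∃ (ξ : rootsOfUnity (torsionOrder p) ℤ_[p]) (s : ZMod (p ^ m)),
        (b : ZMod (p ^ (m + cyclotomicExponent p))) =
          PadicInt.toZModPow (m + cyclotomicExponent p) ((ξ : ℤ_[p]ˣ) : ℤ_[p]) *
            (cyclotomicGenerator p : ZMod (p ^ (m + cyclotomicExponent p))) ^ s.val := by
    intro b
    set Φ : rootsOfUnity (torsionOrder p) ℤ_[p] × ZMod (p ^ m) →
        (ZMod (p ^ (m + cyclotomicExponent p)))ˣ := fun x ↦ (isUnit_classMap p m x).unit with hΦ_def
    have hΦval : ∀ x, (Φ x : ZMod (p ^ (m + cyclotomicExponent p))) =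
        PadicInt.toZModPow (m + cyclotomicExponent p) ((x.1 : ℤ_[p]ˣ) : ℤ_[p]) *
          (cyclotomicGenerator p : ZMod (p ^ (m + cyclotomicExponent p))) ^ x.2.val := fun x ↦
      IsUnit.unit_spec _
    have hΦinj : Function.Injective Φ := fun x y hxy ↦ classMap_injective p m (by
      have h := congr_arg Units.val hxy
      rwa [hΦval, hΦval] at h)
    have hΦbij : Function.Bijective Φ :=
      (Fintype.bijective_iff_injective_and_card Φ).mpr ⟨hΦinj, card_classDomain p m⟩
    obtain ⟨⟨ξ, s⟩, hx⟩ := hΦbij.2 b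
    exact ⟨ξ, s, by rw [← hx, hΦval]⟩
  rw [cyclotomicExponent_eq_one p hp2] at key
  exact key a

/-- For odd `p`, `γ = 1 + p` has order `p^m` modulo `p^{m+1}`, so `γ^{s} = γ^{s mod p^m}` there. [folklore] -/
private theorem cyclotomicGenerator_pow_val_eq_pow_val_castHom (hp2 : p ≠ 2) (m : ℕ) (s : ZMod (p ^ (m + 1))) :
    (cyclotomicGenerator p : ZMod (p ^ (m + 1))) ^ s.val =
      (cyclotomicGenerator p : ZMod (p ^ (m + 1))) ^
        (ZMod.castHom (pow_dvd_pow p m.le_succ) (ZMod (p ^ m)) s).val := by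
  haveI : NeZero (p ^ m) := ⟨pow_ne_zero _ (Fact.out : p.Prime).ne_zero⟩
  have hord : orderOf (cyclotomicGenerator p : ZMod (p ^ (m + 1))) = p ^ m := by
    have h := orderOf_cyclotomicGenerator p m
    rwa [cyclotomicExponent_eq_one p hp2] at h
  rw [ZMod.castHom_apply, ZMod.cast_eq_val, ZMod.val_natCast, ← hord, pow_mod_orderOf]

/-- Norms on `ℚ_p` take values in `p^ℤ ∪ {0}`: `p⁻¹ < ‖x‖ ≤ 1` forces `‖x‖ = 1`.
[cite: Koblitz1984, Ch. I §2 (p. 2: |x|_p = p^(-ord_p x))] -/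
theorem norm_eq_one_of_inv_lt_of_le_one {x : ℚ_[p]} (h1 : (p : ℝ)⁻¹ < ‖x‖) (h2 : ‖x‖ ≤ 1) :
    ‖x‖ = 1 := by
  refine le_antisymm h2 (not_lt.mp fun hlt ↦ ?_)
  have h : ‖x‖ ≤ (p : ℝ) ^ (-1 : ℤ) :=
    (Padic.norm_le_pow_iff_norm_lt_pow_add_one x (-1)).mpr (by simpa using hlt)
  rw [zpow_neg_one] at h
  exact absurd h1 (not_lt.mpr h)

/-! ### §4 The two bridges for `μ_{f,α}`: unit orbit-sum difference ⟹ unit coefficient, and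
constancy modulo `p` ⟹ no unit coefficient -/

/-- **AN-S1, measure form (induction on the level).** `p` odd, `μ_{f,α}` a `ℤ_p`-valued distribution
(`hdist`, `hint`), `|α|_p = 1`. If for some `m` two level-`(m+1)` orbit sums of plus symbols at the units
`γˢ, γ^{s'}` (`s, s' mod p^m`) are NOT congruent mod `p` — `1 ≤ ‖T_{m+1}(γˢ) − T_{m+1}(γ^{s'})‖_p`,
`T_{m+1}(a) = ∑_η [η̄ a/p^{m+1}]⁺_f` — then some coefficient of `L_p(f, α, T)` is a `p`-adic unit.
Descent: either the level-`m` differences are already units (induction), or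
`ν_m(s) − ν_m(s') = α^{−(m+1)}ΔT_{m+1} − α^{−(m+2)}ΔT_m` is a unit (isosceles), so one orbit sum `ν_m` of
the measure is a unit and the abstract certificate applies; at `m = 0` there is one class only.
[cite: MazurTateTeitelbaum1986Invent, §I.10 (10.1)–(10.2), §I.13] -/
theorem exists_norm_padicLCoeff_eq_one_of_orbitSymbolSum [NeZero N] (hp2 : p ≠ 2)
    (hdist : ∀ (n : ℕ) (a : ZMod (p ^ n)),
      ∑ b ∈ Finset.univ.filter (fun b : ZMod (p ^ (n + 1)) ↦
        ZMod.castHom (pow_dvd_pow p n.le_succ) (ZMod (p ^ n)) b = a), msdMeasure f α (n + 1) b =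
        msdMeasure f α n a)
    (hint : ∀ (n : ℕ) (a : ZMod (p ^ n)), ‖msdMeasure f α n a‖ ≤ 1) (hα : ‖α‖ = 1) (m : ℕ) :
    ∀ s s' : ZMod (p ^ m),
      1 ≤ ‖(((∑ᶠ ξ : rootsOfUnity (torsionOrder p) ℤ_[p],
          ratPlusSymbol f ((((PadicInt.toZModPow (m + 1) ((ξ : ℤ_[p]ˣ) : ℤ_[p])) *
            (cyclotomicGenerator p : ZMod (p ^ (m + 1))) ^ s.val).val : ℚ) / (p : ℚ) ^ (m + 1))) -
        (∑ᶠ ξ : rootsOfUnity (torsionOrder p) ℤ_[p],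
          ratPlusSymbol f ((((PadicInt.toZModPow (m + 1) ((ξ : ℤ_[p]ˣ) : ℤ_[p])) *
            (cyclotomicGenerator p : ZMod (p ^ (m + 1))) ^ s'.val).val : ℚ) / (p : ℚ) ^ (m + 1))) :
          ℚ) : ℚ_[p])‖ →
      ∃ k : ℕ, ‖padicLCoeff f α k‖ = 1 := by
  classical
  have hp : p.Prime := Fact.out
  have hp1 : (1 : ℝ) * (p : ℝ)⁻¹ < 1 := by
    rw [one_mul]
    exact inv_lt_one_of_one_lt₀ (by exact_mod_cast hp.one_lt)
  have hαi : ‖α⁻¹‖ = 1 := by rw [norm_inv, hα, inv_one]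
  -- the abstract certificate, specialised to `μ_{f,α}` and its Riemann sums
  have hcert : ∀ (n : ℕ) (s₀ : ZMod (p ^ n)),
      (1 : ℝ) * (p : ℝ)⁻¹ < ‖∑ᶠ ξ : rootsOfUnity (torsionOrder p) ℤ_[p],
        msdMeasure f α (n + cyclotomicExponent p)
          (PadicInt.toZModPow (n + cyclotomicExponent p) ((ξ : ℤ_[p]ˣ) : ℤ_[p]) *
            (cyclotomicGenerator p : ZMod (p ^ (n + cyclotomicExponent p))) ^ s₀.val)‖ →
      ∃ k : ℕ, ‖padicLCoeff f α k‖ = 1 := by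
    intro n s₀ hs₀
    obtain ⟨k, -, hk⟩ := exists_lt_norm_limUnder_riemannSum_of_lt_norm_orbitSum
      (μ := msdMeasure f α) (RS := padicLRiemannSum f α) (fun _ _ ↦ rfl) hdist hint hs₀
    rw [one_mul] at hk
    exact ⟨k, norm_eq_one_of_inv_lt_of_le_one hk (norm_padicLCoeff_le_one hdist hint k)⟩
  induction m with
  | zero =>
    intro s s' h
    haveI : NeZero (p ^ 0) := ⟨pow_ne_zero _ hp.ne_zero⟩
    have hs : s.val = s'.val := by
      have h1 := ZMod.val_lt s
      have h2 := ZMod.val_lt s'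
      simp only [pow_zero] at h1 h2
      omega
    rw [hs, sub_self, Rat.cast_zero, norm_zero] at h
    exact absurd h (not_le.mpr zero_lt_one)
  | succ m ih =>
    intro s s' h
    haveI : NeZero (p ^ m) := ⟨pow_ne_zero _ hp.ne_zero⟩
    haveI : NeZero (p ^ (m + 1)) := ⟨pow_ne_zero _ hp.ne_zero⟩
    set sb := ZMod.castHom (pow_dvd_pow p m.le_succ) (ZMod (p ^ m)) s with hsb_def
    set sb' := ZMod.castHom (pow_dvd_pow p m.le_succ) (ZMod (p ^ m)) s' with hsb'_def
    -- the orbit-sum formula at level `m + 1` for `s` and `s'`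
    have hF := finsum_msdMeasure_orbit_eq (f := f) (α := α) hp2 (n := m + 1) s
    have hF' := finsum_msdMeasure_orbit_eq (f := f) (α := α) hp2 (n := m + 1) s'
    rw [cyclotomicGenerator_pow_val_eq_pow_val_castHom hp2 m s] at hF
    rw [cyclotomicGenerator_pow_val_eq_pow_val_castHom hp2 m s'] at hF'
    -- abbreviations for the symbol sums
    set T2 := fun t : ZMod (p ^ (m + 1)) ↦ (∑ᶠ ξ : rootsOfUnity (torsionOrder p) ℤ_[p],
          ratPlusSymbol f ((((PadicInt.toZModPow (m + 1 + 1) ((ξ : ℤ_[p]ˣ) : ℤ_[p])) *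
            (cyclotomicGenerator p : ZMod (p ^ (m + 1 + 1))) ^ t.val).val : ℚ) /
              (p : ℚ) ^ (m + 1 + 1))) with hT2_def
    set T1 := fun t : ZMod (p ^ m) ↦ (∑ᶠ ξ : rootsOfUnity (torsionOrder p) ℤ_[p],
          ratPlusSymbol f ((((PadicInt.toZModPow (m + 1) ((ξ : ℤ_[p]ˣ) : ℤ_[p])) *
            (cyclotomicGenerator p : ZMod (p ^ (m + 1))) ^ t.val).val : ℚ) /
              (p : ℚ) ^ (m + 1))) with hT1_def
    have h' : 1 ≤ ‖((T2 s - T2 s' : ℚ) : ℚ_[p])‖ := h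
    by_cases hlow : 1 ≤ ‖((T1 sb - T1 sb' : ℚ) : ℚ_[p])‖
    · exact ih sb sb' hlow
    · rw [not_le] at hlow
      -- the orbit sums of the measure at level `m + 1`
      set ν := fun t : ZMod (p ^ (m + 1)) ↦ ∑ᶠ ξ : rootsOfUnity (torsionOrder p) ℤ_[p],
          msdMeasure f α (m + 1 + cyclotomicExponent p)
            (PadicInt.toZModPow (m + 1 + cyclotomicExponent p) ((ξ : ℤ_[p]ˣ) : ℤ_[p]) *
              (cyclotomicGenerator p : ZMod (p ^ (m + 1 + cyclotomicExponent p))) ^ t.val)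
        with hν_def
      have hνs : ν s = α⁻¹ ^ (m + 1 + 1) * ((T2 s : ℚ) : ℚ_[p]) -
          α⁻¹ ^ (m + 1 + 2) * ((T1 sb : ℚ) : ℚ_[p]) := hF
      have hνs' : ν s' = α⁻¹ ^ (m + 1 + 1) * ((T2 s' : ℚ) : ℚ_[p]) -
          α⁻¹ ^ (m + 1 + 2) * ((T1 sb' : ℚ) : ℚ_[p]) := hF'
      have hdiff : ν s - ν s' = α⁻¹ ^ (m + 1 + 1) * ((T2 s - T2 s' : ℚ) : ℚ_[p]) +
          -(α⁻¹ ^ (m + 1 + 2) * ((T1 sb - T1 sb' : ℚ) : ℚ_[p])) := by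
        rw [hνs, hνs']
        push_cast
        ring
      have hbig : 1 ≤ ‖α⁻¹ ^ (m + 1 + 1) * ((T2 s - T2 s' : ℚ) : ℚ_[p])‖ := by
        rw [norm_mul, norm_pow, hαi, one_pow, one_mul]
        exact h'
      have hsmall : ‖-(α⁻¹ ^ (m + 1 + 2) * ((T1 sb - T1 sb' : ℚ) : ℚ_[p]))‖ < 1 := by
        rw [norm_neg, norm_mul, norm_pow, hαi, one_pow, one_mul]
        exact hlow
      have hν1 : 1 ≤ ‖ν s - ν s'‖ := by
        rw [hdiff, IsUltrametricDist.norm_add_eq_max_of_norm_ne_norm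
          (ne_of_gt (lt_of_lt_of_le hsmall hbig))]
        exact le_max_of_le_left hbig
      have hνmax : 1 ≤ max ‖ν s‖ ‖ν s'‖ := by
        refine hν1.trans ?_
        calc ‖ν s - ν s'‖ = ‖ν s + -ν s'‖ := by rw [sub_eq_add_neg]
          _ ≤ max ‖ν s‖ ‖-ν s'‖ := Padic.nonarchimedean _ _
          _ = max ‖ν s‖ ‖ν s'‖ := by rw [norm_neg]
      rcases le_max_iff.mp hνmax with h1 | h1
      · exact hcert (m + 1) s (hp1.trans_le h1)
      · exact hcert (m + 1) s' (hp1.trans_le h1)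

/-- **AN-S2, measure form.** `p` odd, `μ_{f,α}` `ℤ_p`-valued with the distribution relation, `|α|_p = 1`.
If at EVERY level `m + 1` the orbit sums `T_{m+1}(γˢ)`, `s mod p^m`, are mutually congruent mod `p`
(`‖ΔT‖_p < 1`), then every coefficient of `L_p(f, α, T)` lies in `pℤ_p` (`‖c_k‖ ≤ p⁻¹`): the orbit sums
`ν_m` of the measure are then constant mod `p` at every level (MTT (10.1)), and the abstract converse
applies. [cite: MazurTateTeitelbaum1986Invent, §I.10 (10.1)–(10.2), §I.13] -/
theorem norm_padicLCoeff_le_inv_of_orbitSymbolSum [NeZero N] (hp2 : p ≠ 2)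
    (hdist : ∀ (n : ℕ) (a : ZMod (p ^ n)),
      ∑ b ∈ Finset.univ.filter (fun b : ZMod (p ^ (n + 1)) ↦
        ZMod.castHom (pow_dvd_pow p n.le_succ) (ZMod (p ^ n)) b = a), msdMeasure f α (n + 1) b =
        msdMeasure f α n a)
    (hint : ∀ (n : ℕ) (a : ZMod (p ^ n)), ‖msdMeasure f α n a‖ ≤ 1) (hα : ‖α‖ = 1)
    (hsmall : ∀ (m : ℕ) (s s' : ZMod (p ^ m)),
      ‖(((∑ᶠ ξ : rootsOfUnity (torsionOrder p) ℤ_[p],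
          ratPlusSymbol f ((((PadicInt.toZModPow (m + 1) ((ξ : ℤ_[p]ˣ) : ℤ_[p])) *
            (cyclotomicGenerator p : ZMod (p ^ (m + 1))) ^ s.val).val : ℚ) / (p : ℚ) ^ (m + 1))) -
        (∑ᶠ ξ : rootsOfUnity (torsionOrder p) ℤ_[p],
          ratPlusSymbol f ((((PadicInt.toZModPow (m + 1) ((ξ : ℤ_[p]ˣ) : ℤ_[p])) *
            (cyclotomicGenerator p : ZMod (p ^ (m + 1))) ^ s'.val).val : ℚ) / (p : ℚ) ^ (m + 1))) :
          ℚ) : ℚ_[p])‖ < 1)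
    (k : ℕ) : ‖padicLCoeff f α k‖ ≤ (p : ℝ)⁻¹ := by
  classical
  have hp : p.Prime := Fact.out
  have hαi : ‖α⁻¹‖ = 1 := by rw [norm_inv, hα, inv_one]
  have h := norm_limUnder_riemannSum_le_of_forall_norm_orbitSum_sub_le
    (μ := msdMeasure f α) (RS := padicLRiemannSum f α) (fun _ _ ↦ rfl) hdist hint ?_ k
  · rw [one_mul] at h
    exact h
  intro n s s'
  rw [one_mul]
  cases n with
  | zero =>
    haveI : NeZero (p ^ 0) := ⟨pow_ne_zero _ hp.ne_zero⟩
    have hs : s.val = s'.val := by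
      have h1 := ZMod.val_lt s
      have h2 := ZMod.val_lt s'
      simp only [pow_zero] at h1 h2
      omega
    rw [hs, sub_self, norm_zero]
    positivity
  | succ m =>
    haveI : NeZero (p ^ m) := ⟨pow_ne_zero _ hp.ne_zero⟩
    haveI : NeZero (p ^ (m + 1)) := ⟨pow_ne_zero _ hp.ne_zero⟩
    rw [finsum_msdMeasure_orbit_eq (f := f) (α := α) hp2 (n := m + 1) s,
      finsum_msdMeasure_orbit_eq (f := f) (α := α) hp2 (n := m + 1) s',
      cyclotomicGenerator_pow_val_eq_pow_val_castHom hp2 m s,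
      cyclotomicGenerator_pow_val_eq_pow_val_castHom hp2 m s']
    set sb := ZMod.castHom (pow_dvd_pow p m.le_succ) (ZMod (p ^ m)) s with hsb_def
    set sb' := ZMod.castHom (pow_dvd_pow p m.le_succ) (ZMod (p ^ m)) s' with hsb'_def
    have h2 := norm_le_inv_of_norm_lt_one (hsmall (m + 1) s s')
    have h1 := norm_le_inv_of_norm_lt_one (hsmall m sb sb')
    rw [Rat.cast_sub] at h1 h2
    rw [show ∀ (A A' B B' : ℚ_[p]), α⁻¹ ^ (m + 1 + 1) * A - α⁻¹ ^ (m + 1 + 2) * B -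
        (α⁻¹ ^ (m + 1 + 1) * A' - α⁻¹ ^ (m + 1 + 2) * B') =
        α⁻¹ ^ (m + 1 + 1) * (A - A') + -(α⁻¹ ^ (m + 1 + 2) * (B - B')) from fun _ _ _ _ ↦ by ring]
    calc _ ≤ max ‖α⁻¹ ^ (m + 1 + 1) * _‖ ‖-(α⁻¹ ^ (m + 1 + 2) * _)‖ := Padic.nonarchimedean _ _
      _ ≤ (p : ℝ)⁻¹ := by
          simp only [norm_neg, norm_mul, norm_pow, hαi, one_pow, one_mul]
          exact max_le h2 h1

end OddPrime

/-! ### §5 AN-S1 / AN-S2 for an elliptic curve: `TeichOrbitNonConstantAt W p ↔ MuAnZeroAt W p`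
(`p` odd, good ordinary, `E[p]` irreducible) -/

section Elliptic

variable {W : WeierstrassCurve ℚ} [W.IsElliptic] [W.IsGloballyMinimal]

/-- **AN-S1 (bridge of cell `bsd-f3-mu`, MuLambdaCarriers §4, now a theorem).** For `p` odd, `E = W`
good ordinary at `p` with `E[p]` irreducible: if the Teichmüller-orbit sums of plus symbols of every
newform `f` of `E` are non-constant mod `p` at some level (`TeichOrbitNonConstantAt W p`), then some
coefficient of `L_p(f, α_E)` is a `p`-adic unit (`MuAnZeroAt W p`, `μ^an(E,p) = 0`). Inputs, all tree
theorems: the distribution relation of `μ_{f,α}` (`msdMeasure_distribution_of_isNewformOf`), its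
`ℤ_p`-valuedness under irreducibility (`norm_msdMeasure_le_one` with the Eisenstein multiple from
`not_irreducible_of_frobeniusTrace_congr_holds`), `|α|_p = 1` (`unitRoot_coe_spec`), the uniform mod-`p`
Riemann-sum bound (Lucas) and Newton inversion (§0–§4 above). NO hypothesis on the image of `ρ̄_{E,p}`
beyond irreducibility. [cite: MazurTateTeitelbaum1986Invent, §I.10–I.13] [cite: GreenbergVatsal2000, Prop. 3.7] -/
theorem muAnZeroAt_of_teichOrbitNonConstantAt (hp2 : p ≠ 2) (hord : IsOrdinaryAt W p)
    (hirr : W.HasIrreducibleModPGaloisRep p) (hT : Rank1Residual.TeichOrbitNonConstantAt W p) :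
    Rank1Residual.MuAnZeroAt W p := by
  intro N _ f hf
  classical
  have hdist := msdMeasure_distribution_of_isNewformOf hord hf
  obtain ⟨n₀, hpn₀, h0⟩ :=
    exists_intCast_mul_modularSymbol_zero_mem not_irreducible_of_frobeniusTrace_congr_holds hf hirr
  have hpN : ¬ p ∣ N := not_dvd_level_of_isNewformOf hf hord.1
  have hαu : ‖(unitRoot W p : ℚ_[p])‖ = 1 := (unitRoot_coe_spec (W := W) hord).2.1
  have hint : ∀ (n : ℕ) (a : ZMod (p ^ n)), ‖msdMeasure f (unitRoot W p : ℚ_[p]) n a‖ ≤ 1 :=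
    norm_msdMeasure_le_one hp2 hpN hpn₀ h0 hαu
  obtain ⟨n, hn1, a, a', hw⟩ := hT f hf
  obtain ⟨m, rfl⟩ : ∃ m, n = m + 1 := ⟨n - 1, by omega⟩
  obtain ⟨ξ₀, s, ha⟩ := exists_coe_eq_toZModPow_mul_pow hp2 m a
  obtain ⟨ξ₀', s', ha'⟩ := exists_coe_eq_toZModPow_mul_pow hp2 m a'
  rw [ha, ha', teichOrbitSum_eq_finsum f hp2 (by omega), teichOrbitSum_eq_finsum f hp2 (by omega),
    finsum_ratPlusSymbol_mul_toZModPow, finsum_ratPlusSymbol_mul_toZModPow] at hw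
  obtain ⟨k, hk⟩ := exists_norm_padicLCoeff_eq_one_of_orbitSymbolSum hp2 hdist hint hαu m s s' hw
  exact ⟨k, by rw [coeff_padicLFunction]; exact hk⟩

/-- **AN-S2 (the converse bridge, now a theorem).** For `p` odd, `E = W` good ordinary at `p` with
`E[p]` irreducible: if some coefficient of `L_p(f, α_E)` is a unit for every newform `f` of `E`
(`MuAnZeroAt W p`), then the Teichmüller-orbit sums of `f` are non-constant mod `p` at some level `≥ 1`
(`TeichOrbitNonConstantAt W p`) — otherwise all coefficients lie in `pℤ_p`
(`norm_padicLCoeff_le_inv_of_orbitSymbolSum`). [cite: MazurTateTeitelbaum1986Invent, §I.10–I.13]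
[cite: GreenbergVatsal2000, Prop. 3.7] -/
theorem teichOrbitNonConstantAt_of_muAnZeroAt (hp2 : p ≠ 2) (hord : IsOrdinaryAt W p)
    (hirr : W.HasIrreducibleModPGaloisRep p) (hμ : Rank1Residual.MuAnZeroAt W p) :
    Rank1Residual.TeichOrbitNonConstantAt W p := by
  intro N _ f hf
  classical
  have hp : p.Prime := Fact.out
  have hdist := msdMeasure_distribution_of_isNewformOf hord hf
  obtain ⟨n₀, hpn₀, h0⟩ :=
    exists_intCast_mul_modularSymbol_zero_mem not_irreducible_of_frobeniusTrace_congr_holds hf hirr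
  have hpN : ¬ p ∣ N := not_dvd_level_of_isNewformOf hf hord.1
  have hαu : ‖(unitRoot W p : ℚ_[p])‖ = 1 := (unitRoot_coe_spec (W := W) hord).2.1
  have hint : ∀ (n : ℕ) (a : ZMod (p ^ n)), ‖msdMeasure f (unitRoot W p : ℚ_[p]) n a‖ ≤ 1 :=
    norm_msdMeasure_le_one hp2 hpN hpn₀ h0 hαu
  by_contra hcon
  push Not at hcon
  obtain ⟨k, hk⟩ := hμ f hf
  rw [coeff_padicLFunction] at hk
  have hle := norm_padicLCoeff_le_inv_of_orbitSymbolSum hp2 hdist hint hαu ?_ k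
  · rw [hk] at hle
    exact absurd hle (not_le.mpr (inv_lt_one_of_one_lt₀ (by exact_mod_cast hp.one_lt)))
  intro m s s'
  have hu : IsUnit ((cyclotomicGenerator p : ZMod (p ^ (m + 1))) ^ s.val) :=
    (isUnit_cyclotomicGenerator_cast p (m + 1)).pow _
  have hu' : IsUnit ((cyclotomicGenerator p : ZMod (p ^ (m + 1))) ^ s'.val) :=
    (isUnit_cyclotomicGenerator_cast p (m + 1)).pow _
  have h := hcon (m + 1) (by omega) hu.unit hu'.unit
  rw [IsUnit.unit_spec, IsUnit.unit_spec, teichOrbitSum_eq_finsum f hp2 (by omega),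
    teichOrbitSum_eq_finsum f hp2 (by omega)] at h
  exact h

/-- **AN-1 ⟺ `μ^an = 0`, per pair** (`p` odd, good ordinary, `E[p]` irreducible):
`TeichOrbitNonConstantAt W p ↔ MuAnZeroAt W p` — the finite modular-symbol currency of cell `bsd-f3-mu`
(candidate AN-1) is EQUIVALENT to the analytic `μ = 0`, in the kernel.
[cite: MazurTateTeitelbaum1986Invent, §I.10–I.13] [cite: GreenbergVatsal2000, Prop. 3.7] -/
theorem teichOrbitNonConstantAt_iff_muAnZeroAt (hp2 : p ≠ 2) (hord : IsOrdinaryAt W p)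
    (hirr : W.HasIrreducibleModPGaloisRep p) :
    Rank1Residual.TeichOrbitNonConstantAt W p ↔ Rank1Residual.MuAnZeroAt W p :=
  ⟨muAnZeroAt_of_teichOrbitNonConstantAt hp2 hord hirr,
    teichOrbitNonConstantAt_of_muAnZeroAt hp2 hord hirr⟩

end Elliptic

end Literature.NumberTheory.EllipticCurves

end
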